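import Summits.ABC.ABC.Theorems.IUTThetaPilotABCExpThreeDegOne
import Literature.IUT.LogVolume.Corollary22PartIIICore
import Literature.IUT.LogVolume.Corollary22PartIIPointwise
import HarnessLib

/-!
# Route `IUTThetaPilot`, crux `ThetaPartII` (stmt-ABC-19678): the «d = 1 cut» WITHOUT `K_V` in SZPIRO FORM —
# `(abc)_{odd} ≤ C_ε·rad(abc)^{3+ε}` (i.e. `|Δ_{Frey}|_{odd} ≲ N^{6+ε}`) from Theorem 1.10 at the rational points

Mochizuki, *Inter-universal Teichmüller theory IV*, RIMS manuscript (Apr. 2020; = PRIMS **57** (2021)), Cor. 2.2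
(ii) proof pp. 43–48 [cite: Mochizuki2012, IUTchIV Cor. 2.2 (ii) pp. 41–48]; companion of
`IUTThetaPilotABCExpThreeDegOne.lean` (abc-iut-S6), which records the consequence `c < C·rad(abc)^{3+ε}`.
PROOF-ONLY helper on the crux item (does not close it). TAKES NO SIDE on [IUTchIII] Cor. 3.12.

This file exports the SHARPER intermediate statement of the same argument, the Szpiro-type inequality away from
`2` for the Frey–Legendre curves of ALL abc triples: for `0 < ε ≤ 1`,
`log (abc)_{odd} ≤ 3(1+ε)·log rad(abc) + C_ε` (`(abc)_{odd} = ordCompl[2](abc)`; recall `2·log (abc)_{odd} ≤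
log(q^{∤2}(a/c))`, `Cor22.two_mul_log_oddPart_le_logQNotTwo`, and `16(abc)² = Δ` of the Frey curve) — from
`Cor22.Thm110LegendreUpTo 1` (`log_oddPart_le_three_mul_of_thm110LegendreUpTo_one`), hence from the registered
stub `stub_cor312` restricted to degree-1 points (`oddPart_le_of_cor312_degOne`). The `2`-part is absent because
`𝕍^bad_mod` has odd residue characteristic ([IUTchI] Def. 3.1); the passage to `c` (`c ≤ 2(abc)_{odd}`) is what
turns the Szpiro exponent `3` into the abc exponent `3` (rather than `3/2`). CONDITIONAL (`proof.conditional`);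
nothing asserted; no side taken.
-/

set_option linter.dupNamespace false

noncomputable section

namespace Summit.ABC.ABC.Theorems.ThetaPartIIDegOne

open Literature.IUT.LogVolume Literature.IUT.LogVolume.Cor22
open Literature.NumberTheory.DiophantineGeometry Literature.NumberTheory.DiophantineGeometry.GenEll
open NumberField IsDedekindDomain Real

/-- **[IUTchIV] Thm. 1.10 at the RATIONAL points of the `λ`-line (`Cor22.Thm110LegendreUpTo 1`) implies the
Szpiro-type inequality away from `2` for every abc triple: `log (abc)_{odd} ≤ 3(1+ε)·log rad(abc) + C_ε`**
(`0 < ε ≤ 1`). Proof = that of `log_le_three_mul_of_thm110LegendreUpTo_one` (Cor. 2.2 (ii) pp. 43–48 at `λ = a/c`,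
`K_V`-free), stopping before `c ≤ 2(abc)_{odd}`. CONDITIONAL on `h110`; no side taken.
[cite: Mochizuki2012, IUTchIV Cor. 2.2 (ii) proof pp. 43–48] [claim: Mochizuki2012, status: disputed] -/
theorem log_oddPart_le_three_mul_of_thm110LegendreUpTo_one (h110 : Thm110LegendreUpTo 1) {ε : ℝ} (hε : 0 < ε)
    (hε1 : ε ≤ 1) :
    ∃ C : ℝ, ∀ a b c : ℕ, IsABCTriple a b c →
      Real.log (ordCompl[2] (a * b * c) : ℕ) ≤ 3 * (1 + ε) * Real.log (rad a b c) + C := by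
  classical
  obtain ⟨ξ, hξ⟩ := exists_isXiPrm
  have hξ5 : 5 ≤ ξ := hξ.1
  obtain ⟨η, hη⟩ := exists_isEtaPrm
  have hη0 : 0 < η := hη.1
  obtain ⟨G₀, hG₀⟩ := condP6_ratPoint_triple
  obtain ⟨H₃, hH₃0, hH₃⟩ := exists_threshold_sixtyDeltaSq_log_div_sqrt_le
  set ε₁ : ℝ := ε / 6 with hε₁def
  have hε₁0 : 0 < ε₁ := by positivity
  have hε₁1 : ε₁ ≤ 1 := by rw [hε₁def]; linarith
  obtain ⟨Hthr, hHthr⟩ : ∃ Hthr : ℝ, Hthr = H₃ * ε₁ ^ (-(3 : ℝ)) * (1 : ℝ) ^ (-(3 : ℝ)) * ((1 : ℕ) : ℝ) ^ (4 + (1 : ℝ)) :=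
    ⟨_, rfl⟩
  obtain ⟨δ, hδdef⟩ : ∃ δ : ℝ, δ = delta 1 := ⟨_, rfl⟩
  have hδv : δ = 552960 := by rw [hδdef]; unfold delta; norm_num
  have hδ2 : 2 ≤ δ := by rw [hδv]; norm_num
  have hδ5 : 552960 ≤ δ := by rw [hδv]
  -- the height threshold below which everything is absorbed into the constant
  set H₁ : ℝ := ξ ^ 2 + 50 + max G₀ 0 + max Hthr 0 + (80 / ε) ^ 2 + (91 + 6 * δ) ^ 4 with hH₁
  have hG0 : 0 ≤ max G₀ 0 := le_max_right _ _
  have hT0 : 0 ≤ max Hthr 0 := le_max_right _ _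
  have hε80 : 0 ≤ (80 / ε) ^ 2 := sq_nonneg _
  have h43 : 0 ≤ (91 + 6 * δ) ^ 4 := by positivity
  have hξ0 : 0 ≤ ξ ^ 2 := sq_nonneg _
  have hH₁0 : 0 ≤ H₁ := by rw [hH₁]; positivity
  have hlog2 : Real.log 2 ≤ 1 := by have := Real.log_two_lt_d9; linarith
  have hlog2' : 0 < Real.log 2 := Real.log_pos (by norm_num)
  refine ⟨H₁ / 2 + 1 + 5 * ε₁ + 120 * η, fun a b c ht => ?_⟩
  obtain ⟨P, hP⟩ : ∃ P : NFPoint, P = ratPoint ((a : ℚ) / c) := ⟨_, rfl⟩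
  have hmem : P ∈ UPle 1 := by rw [hP]; exact ratPoint_triple_mem ht
  have hPU : P ∈ UP := hmem.1
  have hdeg : P.degree ≤ 1 := hmem.2
  have hInU : P.InU := hPU.1
  -- the quantities of the triple
  have hcpos : 0 < c := by have := ht.2.2.1; have := ht.1; omega
  have hc0 : (0 : ℝ) < c := by exact_mod_cast hcpos
  obtain ⟨X, hX⟩ : ∃ X : ℝ, X = Real.log (ordCompl[2] (a * b * c) : ℕ) := ⟨_, rfl⟩
  obtain ⟨h, hh⟩ : ∃ h : ℝ, h = logQForall P := ⟨_, rfl⟩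
  obtain ⟨R, hR⟩ : ∃ R : ℝ, R = Real.log (rad a b c) := ⟨_, rfl⟩
  have hR0 : 0 ≤ R := by
    have : 0 < rad a b c := by rw [rad_def]; exact Nat.pos_of_ne_zero UniqueFactorizationMonoid.radical_ne_zero
    rw [hR]; exact Real.log_nonneg (by exact_mod_cast this)
  have hX2 : 2 * X ≤ logQNotTwo P := by rw [hX, hP]; exact two_mul_log_oddPart_le_logQNotTwo ht
  have hq2h : logQNotTwo P ≤ h := by rw [hh]; exact logQAvoid_anti P (Finset.empty_subset _)
  have hhht : h ≤ htInfty P := by rw [hh]; exact logQForall_le_htInfty P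
  have hht : htInfty P ≤ 6 * Real.log c + Real.log 256 := by rw [hP]; exact htInfty_ratPoint_triple_le ht
  have hc2 : (c : ℝ) ≤ 2 * (ordCompl[2] (a * b * c) : ℕ) := natCast_le_two_mul_oddPart ht
  have hodd0 : (0 : ℝ) < (ordCompl[2] (a * b * c) : ℕ) := by linarith
  have hlogc : Real.log c ≤ X + Real.log 2 := by
    rw [hX, add_comm, ← Real.log_mul (by norm_num) hodd0.ne']
    exact Real.log_le_log hc0 hc2
  have hlog256 : Real.log 256 = 8 * Real.log 2 := by
    rw [show (256 : ℝ) = 2 ^ 8 by norm_num, Real.log_pow]; norm_num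
  have hh6 : h ≤ 6 * X + 10 := by
    have := Real.log_two_lt_d9
    rw [hlog256] at hht
    linarith
  have hh0 : 0 ≤ h := by rw [hh]; exact logQAvoid_nonneg P ∅
  -- small heights: everything is in the constant
  by_cases hcase : h ≤ H₁
  · have h1 : X ≤ H₁ / 2 + 1 := by linarith
    have h2 : 0 ≤ 3 * (1 + ε) * R := by positivity
    rw [← hR, ← hX]
    linarith
  rw [not_le] at hcase
  -- large heights: the argument of pp. 44–48
  obtain ⟨s, hs⟩ : ∃ s : ℝ, s = Real.sqrt h := ⟨_, rfl⟩
  have hs2 : s ^ 2 = h := by rw [hs]; exact Real.sq_sqrt hh0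
  have hs0 : 0 ≤ s := by rw [hs]; exact Real.sqrt_nonneg h
  have hξs : ξ ≤ s := by
    rw [hs]
    calc ξ = Real.sqrt (ξ ^ 2) := (Real.sqrt_sq (by linarith)).symm
      _ ≤ Real.sqrt h := Real.sqrt_le_sqrt (by linarith)
  have h5s : 5 ≤ s := le_trans hξ5 hξs
  have hspos : 0 < s := by linarith
  have h7s : 7 < s := by
    rw [hs, Real.lt_sqrt (by norm_num)]; linarith
  have h80s : 80 / ε ≤ s := by
    rw [hs]
    calc 80 / ε = Real.sqrt ((80 / ε) ^ 2) := (Real.sqrt_sq (by positivity)).symm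
      _ ≤ Real.sqrt h := Real.sqrt_le_sqrt (by linarith)
  -- the curves without core: `log(q^∀) ≤ 12`
  have hcore : AdmitsCore P := by
    by_contra hno
    have := logQForall_le_of_not_admitsCore hno
    rw [← hh] at this
    linarith
  -- the prime `l` of (P1), (P2), (P3)
  obtain ⟨l, hlp, hP1lo, hP1hi, hP2', hP3⟩ :=
    exists_prime_P1_P2_P3_point P hdeg hξ (by rw [hs, hh] at hξs; exact hξs)
  have hP1lo' : s ≤ l := by rw [hs, hh]; exact hP1lo
  have hP1hi' : (l : ℝ) ≤ 10 * δ * s * Real.log (2 * δ * s ^ 2) := by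
    rw [hs2, hδdef, hs, hh]; exact hP1hi
  have hl7 : 7 ≤ l := by
    have : (7 : ℝ) < l := lt_of_lt_of_le h7s hP1lo'
    exact_mod_cast this.le
  have hl5 : 5 ≤ l := le_trans (by norm_num) hl7
  have hl0 : (0 : ℝ) < l := by exact_mod_cast hlp.pos
  have hlR5 : (5 : ℝ) ≤ l := by exact_mod_cast hl5
  haveI : Fact l.Prime := ⟨hlp⟩
  -- (P3): `log(q^{∤2}) − log(q) ≤ h^{1/2}·log l`
  have hQ1 : logQNotTwo P - logQAvoid P {2, l} ≤ s * Real.log l :=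
    logQNotTwo_sub_logQAvoid_le P hlp hs0 (fun v hv hres => by
      have := hP3 v hv hres; rw [hs, hh]; exact this.le)
  have hl_le : (l : ℝ) ≤ 20 * δ ^ 2 * s ^ 4 := l_le_of_P1 h5s hδ2 hP1hi'
  -- (P5): else `h ≤ (91 + 6δ)⁴ ≤ H₁`
  have hP5 : CondP5 P l := by
    by_contra hno
    have hq0 : logQAvoid P {2, l} = 0 := logQAvoid_pair_eq_zero_of_not_condP5 hno
    have hmain : s ^ 2 ≤ 10 + 3 * s * Real.log l := by rw [hs2]; linarith
    have hb := sq_le_of_le_add_mul_log h5s hδ2 (by norm_num : (0 : ℝ) ≤ 10) hlR5 hl_le hmain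
    rw [hs2] at hb
    have e : (10 + 81 + 6 * δ : ℝ) ^ 4 = (91 + 6 * δ) ^ 4 := by norm_num
    linarith
  -- (P6): the `K_V`-free Galois-image input
  have hP6 : CondP6 P l := by
    rw [hP] at hP2' hP5 ⊢
    refine hG₀ a b c ht l hlp hl7 hP2' hP5 ?_
    have := le_max_left G₀ 0
    rw [← hP, ← hh]
    linarith
  -- (P7) + Theorem 1.10: the HYPOTHESIS, with `d_mod = 1`, `log-diff = 0`
  have hdisp : Display P l η := h110 η hη P hPU hdeg l hlp hl5 hcore hP2' hP5 hP6
  have hLD : P.logDiff = 0 := by rw [hP]; exact logDiff_ratPoint _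
  have hLc : logCondAvoid P {2, l} ≤ R := by
    rw [hR, ← logCond_ratPoint_triple ht]
    have := logCondAvoid_le_logCond P hInU {2, l}
    rw [hP] at this ⊢
    exact this
  have hLc0 : 0 ≤ logCondAvoid P {2, l} := logCondAvoid_nonneg P _
  have hd2 : 1 / 6 * logQAvoid P {2, l} ≤
      (1 + 20 / (l : ℝ)) * logCondAvoid P {2, l} + 20 * (552960 * l + η) := by
    have hd := hdisp
    unfold Display at hd
    have e1 : ((dmod P : ℕ) : ℝ) = 1 := by rw [dmod_eq_one_of_degree_le_one hdeg]; simp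
    rw [e1, hLD] at hd
    have e : (1 + 20 * (1 : ℝ) / l) * (0 + logCondAvoid P {2, l}) + 20 * (2 ^ 12 * 3 ^ 3 * 5 * (1 : ℝ) * l + η)
        = (1 + 20 / (l : ℝ)) * logCondAvoid P {2, l} + 20 * (552960 * l + η) := by ring
    rw [← e]; exact hd
  -- `20/l ≤ ε/4`
  have h20 : 20 / (l : ℝ) ≤ ε / 4 := by
    have h80l : 80 / ε ≤ l := le_trans h80s hP1lo'
    rw [div_le_iff₀ hε] at h80l
    rw [div_le_iff₀ hl0]
    linarith
  -- error terms `∝ s·log(2δh)`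
  obtain ⟨Λ, hΛ⟩ : ∃ Λ : ℝ, Λ = Real.log (2 * δ * h) := ⟨_, rfl⟩
  have hH₁50 : 50 ≤ H₁ := by rw [hH₁]; linarith
  have h2δh : 1 < 2 * δ * h := by rw [hδv]; linarith
  have hΛ0 : 0 ≤ Λ := by rw [hΛ]; exact Real.log_nonneg h2δh.le
  obtain ⟨W, hW⟩ : ∃ W : ℝ, W = s * Λ := ⟨_, rfl⟩
  have hW0 : 0 ≤ W := by rw [hW]; exact mul_nonneg hs0 hΛ0
  -- `l ≤ 10δ·W`
  have hlW : (l : ℝ) ≤ 10 * 552960 * W := by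
    calc (l : ℝ) ≤ 10 * δ * s * Real.log (2 * δ * s ^ 2) := hP1hi'
      _ = 10 * 552960 * W := by rw [hW, hΛ, ← hs2, hδv]; ring
  -- `log l ≤ 3Λ` since `l ≤ 20δ²h² ≤ (2δh)³`
  have hlogl : Real.log l ≤ 3 * Λ := by
    have hle : (l : ℝ) ≤ (2 * δ * h) ^ 3 := by
      have e1 : 20 * δ ^ 2 * s ^ 4 = 20 * δ ^ 2 * h ^ 2 := by rw [← hs2]; ring
      rw [e1] at hl_le
      have hk : 0 ≤ δ ^ 2 * h ^ 2 * (8 * δ * h - 20) :=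
        mul_nonneg (by positivity) (by rw [hδv]; linarith)
      have e2 : δ ^ 2 * h ^ 2 * (8 * δ * h - 20) = 8 * (δ ^ 3 * h ^ 3) - 20 * (δ ^ 2 * h ^ 2) := by ring
      have e3 : (2 * δ * h) ^ 3 = 8 * (δ ^ 3 * h ^ 3) := by ring
      rw [e2] at hk
      rw [e3]
      linarith
    calc Real.log l ≤ Real.log ((2 * δ * h) ^ 3) := Real.log_le_log hl0 hle
      _ = 3 * Λ := by rw [Real.log_pow, hΛ]; norm_num
  have hT2 : s * Real.log l ≤ 3 * W := by
    calc s * Real.log l ≤ s * (3 * Λ) := mul_le_mul_of_nonneg_left hlogl hs0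
      _ = 3 * W := by rw [hW]; ring
  -- the `ε_E`-type threshold: `(60δ)²·Λ/√h ≤ ε₁`, i.e. `3600δ²·W ≤ ε₁·h`
  have hHthrh : Hthr ≤ h := by
    have h1 : Hthr ≤ max Hthr 0 := le_max_left _ _
    have h2 : max Hthr 0 ≤ H₁ := by rw [hH₁]; linarith
    linarith
  have hthr : (60 * delta 1) ^ 2 * Real.log (2 * delta 1 * h) / Real.sqrt h ≤ ε₁ := by
    refine hH₃ H₃ le_rfl 1 le_rfl 1 one_pos le_rfl ε₁ hε₁0 hε₁1 h ?_
    rw [hHthr] at hHthrh; exact hHthrh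
  have hWle : 3600 * 552960 ^ 2 * W ≤ ε / 6 * h := by
    rw [← hδdef, ← hs, ← hΛ, div_le_iff₀ hspos] at hthr
    have hm := mul_le_mul_of_nonneg_left hthr hs0
    calc 3600 * 552960 ^ 2 * W = s * ((60 * δ) ^ 2 * Λ) := by rw [hW, hδv]; ring
      _ ≤ s * (ε₁ * s) := hm
      _ = ε / 6 * h := by rw [← hs2, hε₁def]; ring
  -- the pure arithmetic of pp. 46–48
  have hXle := arith_core hε hε1 hR0 hη0.le hLc hl0 hX2 hQ1 hd2 h20 hlW hT2 hWle hh6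
  rw [hε₁def, ← hR, ← hX]
  linarith


/-- **Szpiro away from `2` for all Frey curves, from [IUTchIII] Cor. 3.12 at the degree-1 Θ-data**: the registered
stub `stub_cor312` restricted to `P.degree ≤ 1` (claim form, DISPUTED — the only hypothesis) implies, for every
`ε > 0`, `(abc)_{odd} ≤ C_ε·rad(abc)^{3+ε}` for EVERY abc triple. CONDITIONAL; nothing asserted; no side taken.
[cite: Mochizuki2012, IUTchIV Cor. 2.2–2.3 pp. 41–55] [claim: Mochizuki2012, status: disputed] -/
theorem oddPart_le_of_cor312_degOne
    (h312 : ∀ P : NFPoint, P ∈ UP → P.degree ≤ 1 → ∀ l : ℕ, l.Prime → 5 ≤ l →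
      Cor22.AdmitsCore P → Cor22.CondP2 P l → Cor22.CondP5 P l → Cor22.CondP6 P l →
        Cor22.Cor312AtDatum P l)
    {ε : ℝ} (hε : 0 < ε) :
    ∃ C : ℝ, 0 < C ∧ ∀ a b c : ℕ, IsABCTriple a b c →
      ((ordCompl[2] (a * b * c) : ℕ) : ℝ) ≤ C * ((rad a b c : ℕ) : ℝ) ^ (3 + ε) := by
  set ε' : ℝ := min ε 1 / 3 with hε'
  have hε'0 : 0 < ε' := by rw [hε']; positivity
  have hε'1 : ε' ≤ 1 := by
    rw [hε']; have := min_le_right ε 1; linarith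
  obtain ⟨C, hC⟩ := log_oddPart_le_three_mul_of_thm110LegendreUpTo_one
    (thm110LegendreUpTo_one_of_cor312_degOne h312) hε'0 hε'1
  refine ⟨Real.exp C, Real.exp_pos C, fun a b c ht => ?_⟩
  have hlog := hC a b c ht
  have hcpos : 0 < c := by have := ht.2.2.1; have := ht.1; omega
  have habc0 : a * b * c ≠ 0 := Nat.mul_ne_zero (Nat.mul_ne_zero ht.1.ne' ht.2.1.ne') hcpos.ne'
  have hY0 : (0 : ℝ) < ((ordCompl[2] (a * b * c) : ℕ) : ℝ) := by
    exact_mod_cast Nat.ordCompl_pos 2 habc0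
  have hrad : 0 < rad a b c := by rw [rad_def]; exact Nat.pos_of_ne_zero UniqueFactorizationMonoid.radical_ne_zero
  have hr0 : (0 : ℝ) < (rad a b c : ℝ) := by exact_mod_cast hrad
  have hr1 : (1 : ℝ) ≤ (rad a b c : ℝ) := by exact_mod_cast hrad
  have hR0 : 0 ≤ Real.log (rad a b c) := Real.log_nonneg hr1
  have h3 : 3 * (1 + ε') * Real.log (rad a b c) ≤ (3 + ε) * Real.log (rad a b c) := by
    apply mul_le_mul_of_nonneg_right _ hR0
    rw [hε']; have := min_le_left ε 1; linarith
  have hle : Real.log ((ordCompl[2] (a * b * c) : ℕ) : ℝ) ≤ (3 + ε) * Real.log (rad a b c) + C := by linarith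
  have h1 : (((ordCompl[2] (a * b * c) : ℕ) : ℝ)) = Real.exp (Real.log ((ordCompl[2] (a * b * c) : ℕ) : ℝ)) :=
    (Real.exp_log hY0).symm
  have h2 : ((rad a b c : ℕ) : ℝ) ^ (3 + ε) = Real.exp ((3 + ε) * Real.log (rad a b c)) := by
    rw [Real.rpow_def_of_pos hr0, mul_comm]
  rw [h1, h2, ← Real.exp_add]
  exact Real.exp_le_exp.mpr (by linarith)


/-! ## The `2`-tame corollary: exponent `3/2 + ε` (appended) -/

/-- **For `2`-TAME triples the exponent drops to `3/2 + ε`**: if `2^{v₂(abc)} ≤ T` then, from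
`(abc)_{odd} ≤ C·rad(abc)^{3+2ε}` (`oddPart_le_of_cor312_degOne`) and the elementary `c² ≤ 2·abc = 2·2^{v₂(abc)}·(abc)_{odd}`
(`ab ≥ c − 1`, `c ≤ abc`), one gets `c ≤ √(2TC)·rad(abc)^{3/2+ε}` — the `2`-part of `log(q^∀)` (dropped from the left
side because `𝕍^bad_mod` has odd residue characteristic) is the ONLY source of the loss `3/2 ↦ 3` in
`abc_exp_three_of_cor312_degOne`; balance at `∞` is what the further passage `3/2 ↦ 1` needs (the tree's `K_V` line,
`Cor22.abc_tame_of_corollary22`). CONDITIONAL on `stub_cor312` at degree-1 points; nothing asserted; no side taken.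
[cite: Mochizuki2012, IUTchIV Cor. 2.2–2.3 pp. 41–55] [claim: Mochizuki2012, status: disputed] -/
theorem abc_exp_three_halves_of_cor312_degOne_of_two_tame
    (h312 : ∀ P : NFPoint, P ∈ UP → P.degree ≤ 1 → ∀ l : ℕ, l.Prime → 5 ≤ l →
      Cor22.AdmitsCore P → Cor22.CondP2 P l → Cor22.CondP5 P l → Cor22.CondP6 P l →
        Cor22.Cor312AtDatum P l)
    {ε : ℝ} (hε : 0 < ε) {T : ℝ} (hT : 0 < T) :
    ∃ C : ℝ, 0 < C ∧ ∀ a b c : ℕ, IsABCTriple a b c → ((ordProj[2] (a * b * c) : ℕ) : ℝ) ≤ T →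
      (c : ℝ) ≤ C * ((rad a b c : ℕ) : ℝ) ^ (3 / 2 + ε) := by
  obtain ⟨C, hC0, hC⟩ := oddPart_le_of_cor312_degOne h312 (by positivity : 0 < 2 * ε)
  refine ⟨Real.sqrt (2 * T * C), Real.sqrt_pos.mpr (by positivity), fun a b c ht h2 => ?_⟩
  have hY := hC a b c ht
  have ha : 0 < a := ht.1
  have hb : 0 < b := ht.2.1
  have habc : a + b = c := ht.2.2.1
  have hcpos : 0 < c := by omega
  have hrad : 0 < rad a b c := by rw [rad_def]; exact Nat.pos_of_ne_zero UniqueFactorizationMonoid.radical_ne_zero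
  have hr0 : (0 : ℝ) < (rad a b c : ℝ) := by exact_mod_cast hrad
  -- `c² ≤ 2·abc`
  have hc2 : c ^ 2 ≤ 2 * (a * b * c) := by
    have hab : a + b ≤ a * b + 1 := by
      have hz : 0 ≤ ((a : ℤ) - 1) * ((b : ℤ) - 1) := mul_nonneg (by omega) (by omega)
      have : (a : ℤ) + b ≤ a * b + 1 := by nlinarith
      exact_mod_cast this
    have h1 : c ≤ a * b + 1 := habc ▸ hab
    have hab1 : 1 ≤ a * b := Nat.one_le_iff_ne_zero.mpr (Nat.mul_ne_zero ha.ne' hb.ne')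
    nlinarith
  -- `abc = 2^{v₂}·(abc)_{odd} ≤ T·(abc)_{odd}`
  have hdec : ((a * b * c : ℕ) : ℝ) = ((ordProj[2] (a * b * c) : ℕ) : ℝ) * ((ordCompl[2] (a * b * c) : ℕ) : ℝ) := by
    exact_mod_cast (Nat.ordProj_mul_ordCompl_eq_self (a * b * c) 2).symm
  have hY0 : (0 : ℝ) ≤ ((ordCompl[2] (a * b * c) : ℕ) : ℝ) := Nat.cast_nonneg _
  have hP0 : (0 : ℝ) ≤ ((ordProj[2] (a * b * c) : ℕ) : ℝ) := Nat.cast_nonneg _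
  have hpow0 : 0 ≤ ((rad a b c : ℕ) : ℝ) ^ (3 + 2 * ε) := Real.rpow_nonneg hr0.le _
  have habc_le : ((a * b * c : ℕ) : ℝ) ≤ T * (C * ((rad a b c : ℕ) : ℝ) ^ (3 + 2 * ε)) := by
    rw [hdec]
    exact mul_le_mul h2 hY hY0 hT.le
  have hc2R : (c : ℝ) ^ 2 ≤ 2 * T * C * ((rad a b c : ℕ) : ℝ) ^ (3 + 2 * ε) := by
    have hc2' : (c : ℝ) ^ 2 ≤ 2 * ((a * b * c : ℕ) : ℝ) := by exact_mod_cast hc2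
    linarith
  -- take square roots
  have hsq : (Real.sqrt (2 * T * C) * ((rad a b c : ℕ) : ℝ) ^ (3 / 2 + ε)) ^ 2 =
      2 * T * C * ((rad a b c : ℕ) : ℝ) ^ (3 + 2 * ε) := by
    have hexp : ((rad a b c : ℕ) : ℝ) ^ (3 + 2 * ε) = (((rad a b c : ℕ) : ℝ) ^ (3 / 2 + ε)) ^ (2 : ℕ) := by
      rw [← Real.rpow_natCast, ← Real.rpow_mul hr0.le]
      congr 1; push_cast; ring
    rw [mul_pow, Real.sq_sqrt (by positivity), hexp]
  have hc0 : (0 : ℝ) ≤ c := Nat.cast_nonneg _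
  have hrhs0 : 0 ≤ Real.sqrt (2 * T * C) * ((rad a b c : ℕ) : ℝ) ^ (3 / 2 + ε) :=
    mul_nonneg (Real.sqrt_nonneg _) (Real.rpow_nonneg hr0.le _)
  rw [← hsq] at hc2R
  exact (pow_le_pow_iff_left₀ hc0 hrhs0 two_ne_zero).mp hc2R

end Summit.ABC.ABC.Theorems.ThetaPartIIDegOne

end
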